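import Summits.AtomisticToContinuum.BoseEinsteinCondensation.Theorems.BECRichardsonGaudinRichardsonAnchorBECBornDefs
import HarnessLib

/-!
# Crux `RichardsonAnchorBEC` (stmt-AtomisticToContinuum-14805), route `BECRichardsonGaudin`, line `registered` —
# stub `stub_bornPolyKinetic`: the kinetic Fock form of the Born trial polynomial

For the Born trial polynomial `A = Σ_{j ≤ J₁} Σ_{S ⊆ W₊, |S| = j} λ_j θ^S X^{pairIndex S}` over the band modes
`↥B_M` (`bornTrialPoly`, `Theorems/…BornDefs`), the kinetic Fock sum is bounded by

  `Σ_{p ∈ B_M} |k_p|² ‖∂_p A‖²_F ≤ Σ_{1 ≤ j ≤ J₁} λ_j² (N−2j)! · 2σ · e_{j−1}`,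

`σ = Σ_{m ∈ W₊} θ_m`, `e_i = pairEsymm L M R i` (`stub_bornPolyKinetic`). Paper proof and tree lemmas:
1. `‖∂_p A‖²_F = ⟨a_p A, a_p A⟩ = ⟨A, a_p† a_p A⟩ = Σ_d d! d_p |A_d|²` (`Fock.fockInner_cr_left`,
   `Fock.fockInner_numberOp_self`): the number operator is diagonal in the occupation basis, so no
   shifted multi-indices are needed (`fockInner_pderiv_self_re`);
2. the occupation multi-indices `pairIndex M N S`, `S ⊆ W₊`, take the value `N − 2|S|` at the zero mode, `1`
   at `±m`, `m ∈ S`, and `0` elsewhere (`pairIndex_apply`; `W₊ ∩ (−W₊) = ∅` by lexicographic positivity), hence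
   they are pairwise distinct (`pairIndex_injective`), have occupation factorial `(N − 2|S|)!`
   (`occFactorial_pairIndex`) and kinetic weight `Σ_p |k_p|² (pairIndex S)_p = 2 Σ_{m∈S} |k_m|²`
   (`kineticWeight_pairIndex`, `waveVector_zero`, `waveVector_neg`);
3. for a sum of monomials with pairwise distinct exponents the kinetic form is the weighted sum of
   `d! |c_d|²` (`kineticForm_sum_monomial`), giving
   `Σ_p |k_p|² ‖∂_p A‖² = Σ_j λ_j² (N−2j)! · 2 Σ_{|S| = j} (∏_S θ)² Σ_{m∈S} |k_m|²`;
4. `|k_m|² θ_m² = θ_m` and `S ↦ S ∖ {m}` injects `{S ∋ m, |S| = j}` into the `(j−1)`-subsets, so the inner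
   sum is at most `σ · e_{j−1}` (`sum_powersetCard_kinetic_le`); the `j = 0` sector has no kinetic energy.
-/

noncomputable section

open MeasureTheory Filter
open scoped ENNReal NNReal ComplexConjugate BigOperators

namespace Summit.AtomisticToContinuum.BoseEinsteinCondensation.Cruxes.RichardsonAnchorBEC.Birth

open Literature.MathematicalPhysics.QuantumManyBody.BoseGas
open MvPolynomial

/-! ## Fock-space generalities -/

/-- `‖∂_p A‖²_F = Σ_d d! · d_p · |A_d|²`: `a_p†` is adjoint to `a_p` and the number operator `a_p† a_p` is
diagonal in the occupation basis. [folklore] -/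
private theorem fockInner_pderiv_self_re {ι : Type*} (A : MvPolynomial ι ℂ) (p : ι) :
    (Fock.fockInner (pderiv p A) (pderiv p A)).re =
      ∑ d ∈ A.support, (Fock.occFactorial d : ℝ) * (d p : ℝ) * ‖coeff d A‖ ^ 2 := by
  rw [← Fock.an_apply, ← Fock.fockInner_cr_left, ← Fock.numberOp_apply, ← Fock.conj_fockInner,
    Fock.fockInner_numberOp_self, Complex.conj_ofReal, Complex.ofReal_re]

/-- **Kinetic form of a sum of distinct monomials.** For `A = Σ_{x ∈ T} c_x X^{φ x}` with `φ` injective on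
`T` and arbitrary mode weights `w`: `Σ_p w_p ‖∂_p A‖²_F = Σ_{x ∈ T} (φ x)! |c_x|² Σ_p w_p (φ x)_p`. [folklore] -/
private theorem kineticForm_sum_monomial {ι κ : Type*} [Fintype ι] (T : Finset κ) (φ : κ → ι →₀ ℕ)
    (c : κ → ℂ) (hφ : Set.InjOn φ T) (w : ι → ℝ) :
    ∑ p, w p * (Fock.fockInner (pderiv p (∑ x ∈ T, monomial (φ x) (c x)))
        (pderiv p (∑ x ∈ T, monomial (φ x) (c x)))).re =
      ∑ x ∈ T, (Fock.occFactorial (φ x) : ℝ) * ‖c x‖ ^ 2 * ∑ p, w p * (φ x p : ℝ) := by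
  classical
  set A := ∑ x ∈ T, monomial (φ x) (c x) with hA
  have hcoeff : ∀ x ∈ T, coeff (φ x) A = c x := by
    intro x hx
    rw [hA, coeff_sum, Finset.sum_eq_single_of_mem x hx]
    · rw [coeff_monomial, if_pos rfl]
    · intro y hy hyx
      rw [coeff_monomial, if_neg]
      exact fun h => hyx (hφ hy hx h)
  have hsupp : A.support ⊆ T.image φ := by
    intro d hd
    rw [mem_support_iff, hA, coeff_sum] at hd
    obtain ⟨x, hx, hne⟩ := Finset.exists_ne_zero_of_sum_ne_zero hd
    rw [coeff_monomial] at hne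
    exact Finset.mem_image.2 ⟨x, hx, of_not_not fun h => hne (if_neg h)⟩
  have hsum : ∀ p, ∑ d ∈ A.support, (Fock.occFactorial d : ℝ) * (d p : ℝ) * ‖coeff d A‖ ^ 2 =
      ∑ x ∈ T, (Fock.occFactorial (φ x) : ℝ) * (φ x p : ℝ) * ‖c x‖ ^ 2 := by
    intro p
    rw [Finset.sum_subset hsupp fun d _ hd => by rw [notMem_support_iff.mp hd, norm_zero]; simp,
      Finset.sum_image hφ]
    exact Finset.sum_congr rfl fun x hx => by rw [hcoeff x hx]
  simp_rw [fockInner_pderiv_self_re, hsum, Finset.mul_sum]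
  rw [Finset.sum_comm]
  refine Finset.sum_congr rfl fun x _ => Finset.sum_congr rfl fun p _ => ?_
  ring

/-! ## Window facts -/

/-- Lexicographic positivity is destroyed by time reversal. [folklore] -/
private theorem not_lexPos_neg {m : Momentum} (hm : lexPos m) : ¬ lexPos (-m) := by
  unfold lexPos at hm ⊢
  simp only [Pi.neg_apply]
  omega

/-- A representative `m ∈ W₊`: `±m` lie in the band, `m ≠ 0`, and `−m` is not a representative. [folklore] -/
private theorem mem_pairReps {M R : ℕ} {m : Momentum} (hm : m ∈ pairReps M R) :
    m ∈ momentumBand M ∧ -m ∈ momentumBand M ∧ m ≠ 0 ∧ -m ∉ pairReps M R := by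
  simp only [pairReps, Finset.mem_filter] at hm
  have hb : m ∈ momentumBand M := (stub_bornDefs M R).2.1 hm.1
  refine ⟨hb, neg_mem_momentumBand hb, ?_, fun h' => ?_⟩
  · rintro rfl
    exact (stub_bornDefs M R).2.2 hm.1
  · simp only [pairReps, Finset.mem_filter] at h'
    exact not_lexPos_neg hm.2 h'.2

/-- `toBand` hits a band mode exactly at its value. [folklore] -/
private theorem toBand_eq_iff {M : ℕ} {m : Momentum} (hm : m ∈ momentumBand M)
    (p : ↥(momentumBand M)) : toBand M m = p ↔ m = p.1 := by
  constructor
  · rintro rfl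
    exact (toBand_val hm).symm
  · rintro rfl
    exact Subtype.ext (toBand_val hm)

/-- The elementary occupation vector of a band mode, evaluated. [folklore] -/
private theorem single_toBand_apply {M : ℕ} {m : Momentum} (hm : m ∈ momentumBand M)
    (p : ↥(momentumBand M)) (n : ℕ) :
    Finsupp.single (toBand M m) n p = if m = p.1 then n else 0 := by
  classical
  rw [Finsupp.single_apply]
  exact if_congr (toBand_eq_iff hm p) rfl rfl

/-! ## The occupation multi-index of a sector -/

/-- Pointwise values of `pairIndex M N S`, `S ⊆ W₊`: `N − 2|S|` at the zero mode, `1` at `±m` for `m ∈ S`,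
`0` elsewhere. [folklore] -/
private theorem pairIndex_apply {M R N : ℕ} {S : Finset Momentum} (hS : S ⊆ pairReps M R)
    (p : ↥(momentumBand M)) :
    pairIndex M N S p = (if (0 : Momentum) = p.1 then N - 2 * S.card else 0) +
      ((if p.1 ∈ S then 1 else 0) + (if -p.1 ∈ S then 1 else 0)) := by
  classical
  rw [pairIndex, Finsupp.add_apply, Finsupp.finsetSum_apply,
    single_toBand_apply (zero_mem_momentumBand M)]
  congr 1
  rw [Finset.sum_congr rfl fun m hm => by
    rw [Finsupp.add_apply, single_toBand_apply (mem_pairReps (hS hm)).1,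
      single_toBand_apply (mem_pairReps (hS hm)).2.1]]
  rw [Finset.sum_add_distrib, Finset.sum_ite_eq']
  congr 1
  simp_rw [neg_eq_iff_eq_neg]
  rw [Finset.sum_ite_eq']

/-- The occupation factorial of a sector: `(pairIndex S)! = (N − 2|S|)!`. [folklore] -/
private theorem occFactorial_pairIndex {M R N : ℕ} {S : Finset Momentum} (hS : S ⊆ pairReps M R) :
    Fock.occFactorial (pairIndex M N S) = (N - 2 * S.card).factorial := by
  classical
  have h0S : (0 : Momentum) ∉ S := fun h => (mem_pairReps (hS h)).2.2.1 rfl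
  rw [Fock.occFactorial_eq_prod_of_subset _ (Finset.subset_univ _),
    Finset.prod_eq_single ⟨0, zero_mem_momentumBand M⟩]
  · rw [pairIndex_apply hS]
    simp [h0S]
  · intro p _ hp
    have hp0 : (0 : Momentum) ≠ p.1 := fun h => hp (Subtype.ext h.symm)
    rw [pairIndex_apply hS, if_neg hp0, zero_add]
    by_cases h1 : p.1 ∈ S
    · have h2 : -p.1 ∉ S := fun h => (mem_pairReps (hS h1)).2.2.2 (hS h)
      simp [h1, h2]
    · by_cases h2 : -p.1 ∈ S <;> simp [h1, h2]
  · exact fun h => (h (Finset.mem_univ _)).elim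

/-- Distinct sectors have distinct occupation multi-indices. [folklore] -/
private theorem pairIndex_injective {M R N : ℕ} {S S' : Finset Momentum} (hS : S ⊆ pairReps M R)
    (hS' : S' ⊆ pairReps M R) (h : pairIndex M N S = pairIndex M N S') : S = S' := by
  suffices key : ∀ S S' : Finset Momentum, S ⊆ pairReps M R → S' ⊆ pairReps M R →
      pairIndex M N S = pairIndex M N S' → S ⊆ S' from
    Finset.Subset.antisymm (key S S' hS hS' h) (key S' S hS' hS h.symm)
  intro S S' hS hS' h v hv
  obtain ⟨hb, -, hne, hneg⟩ := mem_pairReps (hS hv)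
  have h1 := DFunLike.congr_fun h ⟨v, hb⟩
  rw [pairIndex_apply hS, pairIndex_apply hS'] at h1
  have h2 : -v ∉ S := fun h' => hneg (hS h')
  have h3 : -v ∉ S' := fun h' => hneg (hS' h')
  by_contra h4
  simp [hne.symm, hv, h2, h3, h4] at h1

/-- `Σ_p w_p (n e_q)_p = w_q n`. [folklore] -/
private theorem sum_mul_single_apply {M : ℕ} (w : ↥(momentumBand M) → ℝ) (q : ↥(momentumBand M))
    (n : ℕ) : ∑ p, w p * ((Finsupp.single q n p : ℕ) : ℝ) = w q * n := by
  classical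
  simp only [Finsupp.single_apply, Nat.cast_ite, Nat.cast_zero, mul_ite, mul_zero, Finset.sum_ite_eq,
    Finset.mem_univ, if_true]

/-- Additivity of `d ↦ Σ_p w_p d_p`. [folklore] -/
private theorem sum_mul_add_apply {M : ℕ} (w : ↥(momentumBand M) → ℝ) (d e : ↥(momentumBand M) →₀ ℕ) :
    ∑ p, w p * (((d + e) p : ℕ) : ℝ) = ∑ p, w p * ((d p : ℕ) : ℝ) + ∑ p, w p * ((e p : ℕ) : ℝ) := by
  simp only [Finsupp.add_apply, Nat.cast_add, mul_add, Finset.sum_add_distrib]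

/-- Additivity of `d ↦ Σ_p w_p d_p` over a finite family. [folklore] -/
private theorem sum_mul_finsetSum_apply {M : ℕ} {α : Type*} (w : ↥(momentumBand M) → ℝ) (s : Finset α)
    (f : α → ↥(momentumBand M) →₀ ℕ) :
    ∑ p, w p * (((∑ a ∈ s, f a) p : ℕ) : ℝ) = ∑ a ∈ s, ∑ p, w p * ((f a p : ℕ) : ℝ) := by
  simp only [Finsupp.finsetSum_apply, Nat.cast_sum, Finset.mul_sum]
  exact Finset.sum_comm

/-- The kinetic weight of a sector: `Σ_p |k_p|² (pairIndex S)_p = 2 Σ_{m ∈ S} |k_m|²` (the condensate carries no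
kinetic energy, `|k_{−m}| = |k_m|`). [folklore] -/
private theorem kineticWeight_pairIndex (L : ℝ) {M R N : ℕ} {S : Finset Momentum} (hS : S ⊆ pairReps M R) :
    ∑ p : ↥(momentumBand M), ‖waveVector L p.1‖ ^ 2 * ((pairIndex M N S p : ℕ) : ℝ) =
      2 * ∑ m ∈ S, ‖waveVector L m‖ ^ 2 := by
  rw [pairIndex, sum_mul_add_apply, sum_mul_single_apply, sum_mul_finsetSum_apply,
    toBand_val (zero_mem_momentumBand M), waveVector_zero, norm_zero]
  simp only [ne_eq, OfNat.ofNat_ne_zero, not_false_eq_true, zero_pow, zero_mul, zero_add]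
  rw [Finset.mul_sum]
  refine Finset.sum_congr rfl fun m hm => ?_
  obtain ⟨hb, hnb, -, -⟩ := mem_pairReps (hS hm)
  rw [sum_mul_add_apply, sum_mul_single_apply, sum_mul_single_apply, toBand_val hb, toBand_val hnb,
    waveVector_neg, norm_neg]
  push_cast
  ring

/-! ## Elementary weights -/

/-- `|k_m|² θ_m² = θ_m` for `θ_m = 1/|k_m|²` (also when `k_m = 0`). [folklore] -/
private theorem normSq_mul_modeWeight_sq (L : ℝ) (m : Momentum) :
    ‖waveVector L m‖ ^ 2 * modeWeight L m ^ 2 = modeWeight L m := by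
  unfold modeWeight
  rcases eq_or_ne (‖waveVector L m‖ ^ 2) 0 with h | h
  · rw [h]; simp
  · field_simp

/-- The sector-to-subsector bound `Σ_{S ⊆ s, |S| = j} (∏_S θ)² Σ_{m ∈ S} |k_m|² ≤ (Σ_s θ) · Σ_{|T| = j−1} ∏_T θ²`:
`|k_m|²θ_m² = θ_m` and `S ↦ S ∖ {m}` is injective on the `j`-subsets containing `m`. [folklore] -/
private theorem sum_powersetCard_kinetic_le (L : ℝ) (s : Finset Momentum) (j : ℕ) :
    ∑ S ∈ s.powersetCard j, (∏ m ∈ S, modeWeight L m) ^ 2 * ∑ m ∈ S, ‖waveVector L m‖ ^ 2 ≤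
      (∑ m ∈ s, modeWeight L m) * ∑ T ∈ s.powersetCard (j - 1), ∏ m ∈ T, modeWeight L m ^ 2 := by
  classical
  have h1 : ∀ S ∈ s.powersetCard j, (∏ m ∈ S, modeWeight L m) ^ 2 * ∑ m ∈ S, ‖waveVector L m‖ ^ 2 =
      ∑ m ∈ S, modeWeight L m * ∏ m' ∈ S.erase m, modeWeight L m' ^ 2 := by
    intro S _
    rw [Finset.mul_sum]
    refine Finset.sum_congr rfl fun m hm => ?_
    rw [← Finset.prod_pow, ← Finset.mul_prod_erase S _ hm]
    linear_combination (∏ x ∈ S.erase m, modeWeight L x ^ 2) * normSq_mul_modeWeight_sq L m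
  rw [Finset.sum_congr rfl h1,
    Finset.sum_comm' (t' := s) (s' := fun m => (s.powersetCard j).filter fun S => m ∈ S) ?_]
  · rw [Finset.sum_mul]
    refine Finset.sum_le_sum fun m _ => ?_
    rw [← Finset.mul_sum]
    refine mul_le_mul_of_nonneg_left ?_ (by unfold modeWeight; positivity)
    have hinj : Set.InjOn (fun S : Finset Momentum => S.erase m)
        ((s.powersetCard j).filter fun S => m ∈ S) := by
      intro S hS S' hS' h
      have hmS : m ∈ S := (Finset.mem_filter.1 (Finset.mem_coe.1 hS)).2
      have hmS' : m ∈ S' := (Finset.mem_filter.1 (Finset.mem_coe.1 hS')).2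
      rw [← Finset.insert_erase hmS, ← Finset.insert_erase hmS']
      exact congrArg (insert m) h
    rw [← Finset.sum_image (f := fun T => ∏ m' ∈ T, modeWeight L m' ^ 2) hinj]
    refine Finset.sum_le_sum_of_subset_of_nonneg ?_ fun T _ _ =>
      Finset.prod_nonneg fun _ _ => sq_nonneg _
    intro T hT
    obtain ⟨S, hS, rfl⟩ := Finset.mem_image.1 hT
    obtain ⟨hS1, hS2⟩ := Finset.mem_filter.1 hS
    obtain ⟨hS3, hS4⟩ := Finset.mem_powersetCard.1 hS1
    exact Finset.mem_powersetCard.2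
      ⟨(Finset.erase_subset _ _).trans hS3, by rw [Finset.card_erase_of_mem hS2, hS4]⟩
  · intro S m
    simp only [Finset.mem_filter, Finset.mem_powersetCard]
    constructor
    · rintro ⟨⟨h1, h2⟩, h3⟩
      exact ⟨⟨⟨h1, h2⟩, h3⟩, h1 h3⟩
    · rintro ⟨⟨h1, h3⟩, -⟩
      exact ⟨h1, h3⟩

/-! ## The stub -/

/-- **Kinetic Fock form of the Born trial polynomial** (stub U2b of the registered line):
`Σ_{p ∈ B_M} |k_p|² ‖∂_p A‖²_F ≤ Σ_{1 ≤ j ≤ J₁} λ_j² (N−2j)! · (2 Σ_{W₊} θ) · e_{j−1}`. The sectors of `A` are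
orthogonal occupation vectors, the zero mode carries no kinetic energy, each pair `±m` of a sector carries
`2|k_m|²`, and `|k_m|² θ_m² = θ_m`. [folklore] -/
theorem stub_bornPolyKinetic :
    ∀ (γ L : ℝ) (M R N J₁ : ℕ), 0 < L → 2 * J₁ + 2 ≤ N →
      ∑ p : ↥(momentumBand M), ‖waveVector L p.1‖ ^ 2 *
          (Fock.fockInner (MvPolynomial.pderiv p (bornTrialPoly γ L M R N J₁))
            (MvPolynomial.pderiv p (bornTrialPoly γ L M R N J₁))).re ≤
        ∑ j ∈ Finset.Ico 1 (J₁ + 1), bornCoeff γ L M R N j ^ 2 * ((N - 2 * j).factorial : ℝ) *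
          (2 * ∑ m ∈ pairReps M R, modeWeight L m) * pairEsymm L M R (j - 1) := by
  intro γ L M R N J₁ _ _
  classical
  -- the trial polynomial as one sum over the sigma finset of sectors `(j, S)`
  have hA : bornTrialPoly γ L M R N J₁ =
      ∑ x ∈ (Finset.range (J₁ + 1)).sigma (fun j => (pairReps M R).powersetCard j),
        monomial (pairIndex M N x.2) (((bornCoeff γ L M R N x.1 * ∏ m ∈ x.2, modeWeight L m : ℝ)) : ℂ) := by
    rw [bornTrialPoly, Finset.sum_sigma']
  have hinj : Set.InjOn (fun x : (Σ _ : ℕ, Finset Momentum) => pairIndex M N x.2)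
      ((Finset.range (J₁ + 1)).sigma (fun j => (pairReps M R).powersetCard j)) := by
    intro x hx y hy hxy
    rw [Finset.coe_sigma, Set.mem_sigma_iff] at hx hy
    obtain ⟨hxS, hxc⟩ := Finset.mem_powersetCard.1 (Finset.mem_coe.1 hx.2)
    obtain ⟨hyS, hyc⟩ := Finset.mem_powersetCard.1 (Finset.mem_coe.1 hy.2)
    have h2 : x.2 = y.2 := pairIndex_injective hxS hyS hxy
    have h1 : x.1 = y.1 := by rw [← hxc, ← hyc, h2]
    exact Sigma.ext h1 (heq_of_eq h2)
  -- sector-by-sector evaluation of the kinetic form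
  have hLHS : ∑ x ∈ (Finset.range (J₁ + 1)).sigma (fun j => (pairReps M R).powersetCard j),
      (Fock.occFactorial (pairIndex M N x.2) : ℝ) *
        ‖(((bornCoeff γ L M R N x.1 * ∏ m ∈ x.2, modeWeight L m : ℝ)) : ℂ)‖ ^ 2 *
        ∑ p : ↥(momentumBand M), ‖waveVector L p.1‖ ^ 2 * ((pairIndex M N x.2 p : ℕ) : ℝ) =
      ∑ j ∈ Finset.range (J₁ + 1), bornCoeff γ L M R N j ^ 2 * ((N - 2 * j).factorial : ℝ) *
        (2 * ∑ S ∈ (pairReps M R).powersetCard j,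
          (∏ m ∈ S, modeWeight L m) ^ 2 * ∑ m ∈ S, ‖waveVector L m‖ ^ 2) := by
    rw [Finset.sum_sigma]
    refine Finset.sum_congr rfl fun j _ => ?_
    rw [Finset.mul_sum, Finset.mul_sum]
    refine Finset.sum_congr rfl fun S hS => ?_
    obtain ⟨hSsub, hScard⟩ := Finset.mem_powersetCard.1 hS
    dsimp only
    rw [occFactorial_pairIndex hSsub, hScard, kineticWeight_pairIndex L hSsub, Complex.norm_real,
      Real.norm_eq_abs, sq_abs]
    ring
  have key := kineticForm_sum_monomial
    ((Finset.range (J₁ + 1)).sigma (fun j => (pairReps M R).powersetCard j))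
    (fun x => pairIndex M N x.2)
    (fun x => (((bornCoeff γ L M R N x.1 * ∏ m ∈ x.2, modeWeight L m : ℝ)) : ℂ)) hinj
    (fun p => ‖waveVector L p.1‖ ^ 2)
  rw [hA, key, hLHS, Finset.sum_range_eq_add_Ico _ (Nat.succ_pos J₁)]
  simp only [Finset.powersetCard_zero, Finset.sum_singleton, Finset.sum_empty, mul_zero, zero_add]
  refine Finset.sum_le_sum fun j _ => ?_
  have h := sum_powersetCard_kinetic_le L (pairReps M R) j
  have hnn : 0 ≤ bornCoeff γ L M R N j ^ 2 * ((N - 2 * j).factorial : ℝ) * 2 := by positivity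
  calc bornCoeff γ L M R N j ^ 2 * ((N - 2 * j).factorial : ℝ) *
        (2 * ∑ S ∈ (pairReps M R).powersetCard j,
          (∏ m ∈ S, modeWeight L m) ^ 2 * ∑ m ∈ S, ‖waveVector L m‖ ^ 2)
      = bornCoeff γ L M R N j ^ 2 * ((N - 2 * j).factorial : ℝ) * 2 *
          ∑ S ∈ (pairReps M R).powersetCard j,
            (∏ m ∈ S, modeWeight L m) ^ 2 * ∑ m ∈ S, ‖waveVector L m‖ ^ 2 := by ring
    _ ≤ bornCoeff γ L M R N j ^ 2 * ((N - 2 * j).factorial : ℝ) * 2 *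
          ((∑ m ∈ pairReps M R, modeWeight L m) *
            ∑ T ∈ (pairReps M R).powersetCard (j - 1), ∏ m ∈ T, modeWeight L m ^ 2) :=
        mul_le_mul_of_nonneg_left h hnn
    _ = _ := by rw [pairEsymm]; ring

end Summit.AtomisticToContinuum.BoseEinsteinCondensation.Cruxes.RichardsonAnchorBEC.Birth

end
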